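import Literature.NumberTheory.GaloisRepresentations.ContinuousH2
import Literature.NumberTheory.GaloisRepresentations.GaloisCohomology
import Literature.NumberTheory.GaloisRepresentations.AbsGaloisGroupCompact
import Literature.Algebra.Homology.GroupCohomologyInnerAutomorphism
import Mathlib.Topology.LocallyConstant.Basic
import HarnessLib

/-!
# Pulling finite-group `2`-cocycles back to continuous cohomology along compatible pairs, and the
# triviality of inner automorphisms (Serre, *Galois Cohomology* I §2.4–§2.5; *Local Fields* VII §5 Prop. 3)

Topic `NumberTheory/GaloisRepresentations`; namespace `Literature.NumberTheory.GaloisRepresentations`.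
Definitions with bodies and theorems; no named fact, no instance, no notation.

Let `G` be an (abstract) group, `A : Rep ℤ G`, `Γ` a topological group and `X : TopRep ℤ Γ`.  A
**compatible pair** `(f, φ) : (Γ, X) → (G, A)` is a locally constant group homomorphism `f : Γ → G`
together with an additive `φ : A → X` with `φ (f(s) · a) = s · φ(a)` (Serre, *Galois Cohomology* I §2.4:
a morphism of pairs).  It pulls an inhomogeneous `2`-cocycle `b` of `G` back to the CONTINUOUS (locally
constant) `2`-cocycle `(s, t) ↦ φ (b (f s, f t))` of `Γ` (`CompatiblePair.pull`), hence induces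
`H²(G, A) → H²_cont(Γ, X)` between Mathlib's `groupCohomology` and `continuousCohomology`.  This is the
shape of every inflation / localisation map between the finite Galois layers of the class-field-theory
engine (Mathlib `Rep ℤ Gal(E/F)`) and the tree's `galoisCohomology` (door-c6 g9/g10 `infTwo`,
`unitsInfTwo`, `res_infTwo`; door-c5's semi-local Shapiro isomorphisms), once all intermediate
`groupCohomology.map`s / `ContinuousCohomology.map`s are composed.

* §1 `CompatiblePair`, `pull`, `pull_apply`; composition with a finite-level pair morphism
  (`compMap`, `pull_mapCocycles₂`) and with a continuous pullback (`pullback`, `pullback_pull`) — so a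
  chain `H²(G, A) → H²(G', A') → … → H²_cont(Γ, X) → H²_cont(Γ', X')` collapses to ONE `pull`.
* §2 **`twoCocycleClass_pull_eq_of_conj`**: two compatible pairs that differ by an INNER automorphism of
  `(G, A)` — `f₂(s) = σ⁻¹ f₁(s) σ`, `φ₂(a) = φ₁(σ · a)` — induce the same map on `H²`
  (Serre, *Local Fields* VII §5 Prop. 3 / *Galois Cohomology* I §2.5: `G` acts trivially on `H^q(G, A)`;
  here through the tree's `Literature.Algebra.Homology.map_conj_eq_id` at the finite level, the
  coboundary being transported along the pair, `twoCocycleClass_pull_eq_zero_of_mem_coboundaries`).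
* §3 the case of units: `A = Rep.ofAlgebraAutOnUnits F E` (`Eˣ` under `Gal(E/F)`) and `X = K̄ˣ`
  (the tree's `units K`, `Γ = Γ_K`); if the module components of two pairs are given by two ring
  embeddings `ι₁, ι₂ : E → K̄` with `ι₂ = ι₁ ∘ σ` for some `σ ∈ Gal(E/F)`, then the group components
  AUTOMATICALLY differ by the inner automorphism of `σ` (`ι₁` is injective and both pairs are compatible),
  so the two pulled-back classes agree (`twoCocycleClass_pull_eq_of_ringHom_eq_comp`).  This is the form
  consumed by the local–global dictionary for Brauer classes of the bsd-schneider cell: the two routes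
  `H²(Gal(E/F), Eˣ) → H²(Γ_{F_v}, F̄_vˣ)` (inflate to `Γ_F` then localise / restrict to the decomposition
  group, complete, inflate) are compatible pairs attached to two `F`-embeddings `E → F̄_v`, which differ by
  an element of `Gal(E/F)` because `E/F` is normal.

HONEST FRAMING: homological algebra only; written for Route A (Poitou–Tate) of the bsd-schneider cell,
crux `AnticycControlAdditiveK`, but nothing arithmetic is proved here.

## References
* J.-P. Serre, *Galois Cohomology* (1997), Ch. I §2.4 (compatible pairs), §2.5 (conjugation acts
  trivially). [SerreGaloisCohomology1997]
* J.-P. Serre, *Local Fields*, GTM 67 (1979), Ch. VII §5 Prop. 3. [SerreLocalFields1979]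
-/

noncomputable section

open CategoryTheory groupCohomology Function

namespace Literature.NumberTheory.GaloisRepresentations

open Literature.Algebra.Homology

/-! ## §1. Compatible pairs and the pulled-back continuous `2`-cocycle -/

/-- **A compatible pair `(f, φ) : (Γ, X) → (G, A)`**: a locally constant homomorphism `f : Γ → G` and an
additive `φ : A → X` with `φ (f(s) · a) = s · φ(a)`. [cite: SerreGaloisCohomology1997, Ch. I §2.4] -/
structure CompatiblePair {G : Type} [Group G] (A : Rep.{0} ℤ G) {Γ : Type} [Group Γ] [TopologicalSpace Γ]
    (X : TopRep.{0} ℤ Γ) where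
  /-- the group component `f : Γ → G` -/
  f : Γ →* G
  /-- `f` is locally constant (continuous for the discrete topology of `G`) -/
  isLocallyConstant_f : IsLocallyConstant f
  /-- the module component `φ : A → X` -/
  φ : A.V →+ X.V
  /-- compatibility `φ (f(s) · a) = s · φ(a)` -/
  comm : ∀ (s : Γ) (a : A.V), φ (A.ρ (f s) a) = X.ρ s (φ a)

namespace CompatiblePair

variable {G : Type} [Group G] {A : Rep.{0} ℤ G} {Γ : Type} [Group Γ] [TopologicalSpace Γ]
  [IsTopologicalGroup Γ] {X : TopRep.{0} ℤ Γ}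

omit [IsTopologicalGroup Γ] in
/-- The function `(s, t) ↦ (f s, f t)` is locally constant. [cite: SerreGaloisCohomology1997, Ch. I §2.4] -/
theorem isLocallyConstant_prod (P : CompatiblePair A X) :
    IsLocallyConstant fun p : Γ × Γ => (P.f p.1, P.f p.2) :=
  (P.isLocallyConstant_f.comp_continuous continuous_fst).prodMk
    (P.isLocallyConstant_f.comp_continuous continuous_snd)

omit [IsTopologicalGroup Γ] in
/-- **The pulled-back continuous `2`-cocycle `(s, t) ↦ φ (b (f s, f t))`** of an inhomogeneous
`2`-cocycle `b` of `G`. [cite: SerreGaloisCohomology1997, Ch. I §2.4] -/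
def pull (P : CompatiblePair A X) (b : cocycles₂ A) : contTwoCocycles X :=
  ⟨⟨fun p => P.φ (b (P.f p.1, P.f p.2)),
    ((P.isLocallyConstant_prod).comp (fun q : G × G => P.φ (b q))).continuous⟩, fun σ τ υ => by
    change X.ρ σ (P.φ (b (P.f τ, P.f υ))) + P.φ (b (P.f σ, P.f (τ * υ))) =
      P.φ (b (P.f (σ * τ), P.f υ)) + P.φ (b (P.f σ, P.f τ))
    rw [← P.comm, map_mul, map_mul, ← map_add, ← map_add,
      ← (mem_cocycles₂_iff b).1 b.2 (P.f σ) (P.f τ) (P.f υ)]⟩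

omit [IsTopologicalGroup Γ] in
/-- Unfolding `pull`. [cite: SerreGaloisCohomology1997, Ch. I §2.4] -/
@[simp] theorem pull_apply (P : CompatiblePair A X) (b : cocycles₂ A) (s t : Γ) :
    (P.pull b).1 (s, t) = P.φ (b (P.f s, P.f t)) := rfl

omit [IsTopologicalGroup Γ] in
/-- `pull` is compatible with subtraction. [cite: SerreGaloisCohomology1997, Ch. I §2.4] -/
theorem pull_sub (P : CompatiblePair A X) (b b' : cocycles₂ A) : P.pull (b - b') = P.pull b - P.pull b' :=
  Subtype.ext (ContinuousMap.ext fun ⟨s, t⟩ => by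
    change P.φ ((b - b') (P.f s, P.f t)) = P.φ (b (P.f s, P.f t)) - P.φ (b' (P.f s, P.f t))
    rw [← map_sub]
    rfl)

omit [IsTopologicalGroup Γ] in
/-- **Precomposition with a morphism of finite-level pairs** `(g, ψ) : (G, A) → (G', B)` (`g : G → G'`,
`ψ : Res_g B ⟶ A`): the pair `(g ∘ f, φ ∘ ψ) : (Γ, X) → (G', B)`. [cite: SerreGaloisCohomology1997, Ch. I §2.4] -/
def compMap {G' : Type} [Group G'] {B : Rep.{0} ℤ G'} (P : CompatiblePair A X) (g : G →* G')
    (ψ : Rep.res g B ⟶ A) : CompatiblePair B X where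
  f := g.comp P.f
  isLocallyConstant_f := P.isLocallyConstant_f.comp g
  φ := { toFun := fun a => P.φ (ψ.hom a)
         map_zero' := by rw [map_zero, map_zero]
         map_add' := fun a a' => by rw [map_add, map_add] }
  comm s a := by
    change P.φ (ψ.hom (B.ρ (g (P.f s)) a)) = X.ρ s (P.φ (ψ.hom a))
    rw [← P.comm]
    exact congrArg P.φ (Rep.hom_comm_apply ψ (P.f s) a)

omit [IsTopologicalGroup Γ] in
/-- Unfolding the module component of `compMap`. [cite: SerreGaloisCohomology1997, Ch. I §2.4] -/
@[simp] theorem compMap_φ_apply {G' : Type} [Group G'] {B : Rep.{0} ℤ G'} (P : CompatiblePair A X)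
    (g : G →* G') (ψ : Rep.res g B ⟶ A) (a : B.V) : (P.compMap g ψ).φ a = P.φ (ψ.hom a) := rfl

omit [IsTopologicalGroup Γ] in
/-- Unfolding the group component of `compMap`. [cite: SerreGaloisCohomology1997, Ch. I §2.4] -/
@[simp] theorem compMap_f_apply {G' : Type} [Group G'] {B : Rep.{0} ℤ G'} (P : CompatiblePair A X)
    (g : G →* G') (ψ : Rep.res g B ⟶ A) (s : Γ) : (P.compMap g ψ).f s = g (P.f s) := rfl

omit [IsTopologicalGroup Γ] in
/-- **`pull` of a mapped cocycle is `pull` along the composite pair**: `pull_{(f,φ)} (Z²(g, ψ) b) =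
pull_{(g∘f, φ∘ψ)} b` at the cocycle level. [cite: SerreGaloisCohomology1997, Ch. I §2.4] -/
theorem pull_mapCocycles₂ {G' : Type} [Group G'] {B : Rep.{0} ℤ G'} (P : CompatiblePair A X) (g : G →* G')
    (ψ : Rep.res g B ⟶ A) (b : cocycles₂ B) :
    P.pull (mapCocycles₂ g ψ b) = (P.compMap g ψ).pull b :=
  Subtype.ext (ContinuousMap.ext fun ⟨_, _⟩ => rfl)

omit [IsTopologicalGroup Γ] in
/-- **Postcomposition with a continuous pullback** `(θ, ψ) : (Γ', Y) → (Γ, X)` (`θ : Γ' → Γ` continuous,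
`ψ : res_θ X ⟶ Y`): the pair `(f ∘ θ, ψ ∘ φ) : (Γ', Y) → (G, A)`. [cite: SerreGaloisCohomology1997, Ch. I §2.4] -/
def pullback {Γ' : Type} [Group Γ'] [TopologicalSpace Γ'] {Y : TopRep.{0} ℤ Γ'} (P : CompatiblePair A X)
    (θ : Γ' →ₜ* Γ) (ψ : TopRep.res (θ : Γ' →* Γ) X ⟶ Y) : CompatiblePair A Y where
  f := P.f.comp (θ : Γ' →* Γ)
  isLocallyConstant_f := P.isLocallyConstant_f.comp_continuous θ.continuous
  φ := { toFun := fun a => ψ.hom (P.φ a)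
         map_zero' := by rw [map_zero, map_zero]
         map_add' := fun a a' => by rw [map_add, map_add] }
  comm s a := by
    change ψ.hom (P.φ (A.ρ (P.f (θ s)) a)) = Y.ρ s (ψ.hom (P.φ a))
    rw [P.comm]
    exact TopRep.hom_comm_apply ψ s (P.φ a)

omit [IsTopologicalGroup Γ] in
/-- Unfolding the module component of `pullback`. [cite: SerreGaloisCohomology1997, Ch. I §2.4] -/
@[simp] theorem pullback_φ_apply {Γ' : Type} [Group Γ'] [TopologicalSpace Γ'] {Y : TopRep.{0} ℤ Γ'}
    (P : CompatiblePair A X) (θ : Γ' →ₜ* Γ) (ψ : TopRep.res (θ : Γ' →* Γ) X ⟶ Y) (a : A.V) :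
    (P.pullback θ ψ).φ a = ψ.hom (P.φ a) := rfl

omit [IsTopologicalGroup Γ] in
/-- Unfolding the group component of `pullback`. [cite: SerreGaloisCohomology1997, Ch. I §2.4] -/
@[simp] theorem pullback_f_apply {Γ' : Type} [Group Γ'] [TopologicalSpace Γ'] {Y : TopRep.{0} ℤ Γ'}
    (P : CompatiblePair A X) (θ : Γ' →ₜ* Γ) (ψ : TopRep.res (θ : Γ' →* Γ) X ⟶ Y) (s : Γ') :
    (P.pullback θ ψ).f s = P.f (θ s) := rfl

omit [IsTopologicalGroup Γ] in
/-- **The continuous pullback of `pull b` is `pull b` along the composite pair** (cocycle level).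
[cite: SerreGaloisCohomology1997, Ch. I §2.4] -/
theorem pullback_pull {Γ' : Type} [Group Γ'] [TopologicalSpace Γ'] {Y : TopRep.{0} ℤ Γ'}
    (P : CompatiblePair A X) (θ : Γ' →ₜ* Γ) (ψ : TopRep.res (θ : Γ' →* Γ) X ⟶ Y) (b : cocycles₂ A) :
    contTwoCocycles.pullback θ ψ (P.pull b) = (P.pullback θ ψ).pull b :=
  Subtype.ext (ContinuousMap.ext fun ⟨_, _⟩ => rfl)

/-! ## §2. Pairs that differ by an inner automorphism induce the same map on `H²` -/

variable [LocallyCompactSpace Γ]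

/-- **A pulled-back finite-level coboundary is a continuous coboundary**: if `b = d e` then
`[pull b] = 0`. [cite: SerreGaloisCohomology1997, Ch. I §2.4] -/
theorem twoCocycleClass_pull_eq_zero_of_mem_coboundaries (P : CompatiblePair A X) (b : cocycles₂ A)
    (hb : (b : G × G → A.V) ∈ coboundaries₂ A) : twoCocycleClass X (P.pull b) = 0 := by
  obtain ⟨e, he⟩ := hb
  rw [twoCocycleClass_eq_zero_iff]
  refine ⟨⟨fun s => P.φ (e (P.f s)), (P.isLocallyConstant_f.comp fun g => P.φ (e g)).continuous⟩,
    fun s t => ?_⟩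
  have h := congrFun he (P.f s, P.f t)
  rw [d₁₂_hom_apply] at h
  change P.φ (b (P.f s, P.f t)) = X.ρ s (P.φ (e (P.f t))) - P.φ (e (P.f (s * t))) + P.φ (e (P.f s))
  rw [← h, ← P.comm, map_mul, map_add, map_sub]

/-- **Two compatible pairs that differ by an inner automorphism of `(G, A)` induce the same map
`H²(G, A) → H²_cont(Γ, X)`**: if `f₂(s) = σ⁻¹ f₁(s) σ` and `φ₂(a) = φ₁(σ · a)` then
`[pull₂ b] = [pull₁ b]` for every `2`-cocycle `b` (the conjugate cocycle `b^σ = Z²(c_σ, ρ(σ)) b` has the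
same class as `b` — `map_conj_eq_id` — and `pull₂ b = pull₁ b^σ`).
[cite: SerreLocalFields1979, Ch. VII §5 Prop. 3][cite: SerreGaloisCohomology1997, Ch. I §2.5] -/
theorem twoCocycleClass_pull_eq_of_conj (P₁ P₂ : CompatiblePair A X) (σ : G)
    (hf : ∀ s, P₂.f s = σ⁻¹ * P₁.f s * σ) (hφ : ∀ a, P₂.φ a = P₁.φ (A.ρ σ a)) (b : cocycles₂ A) :
    twoCocycleClass X (P₂.pull b) = twoCocycleClass X (P₁.pull b) := by
  -- the conjugate cocycle `b^σ`
  have hclass : H2π A (mapCocycles₂ (conjBy σ) (conjRepHom A σ) b) = H2π A b := by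
    rw [← H2π_comp_map_apply, map_conj_eq_id A σ 2]
    rfl
  have hcob := (H2π_eq_iff _ b).1 hclass
  -- `pull₂ b = pull₁ b^σ`
  have hpull : P₂.pull b = P₁.pull (mapCocycles₂ (conjBy σ) (conjRepHom A σ) b) :=
    Subtype.ext (ContinuousMap.ext fun ⟨s, t⟩ => by
      rw [pull_apply, pull_apply, hφ, hf, hf]
      rfl)
  have hzero : twoCocycleClass X (P₁.pull (mapCocycles₂ (conjBy σ) (conjRepHom A σ) b - b)) = 0 :=
    twoCocycleClass_pull_eq_zero_of_mem_coboundaries P₁ _ hcob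
  rw [pull_sub, twoCocycleClass_sub, sub_eq_zero] at hzero
  rw [hpull, hzero]

end CompatiblePair

/-! ## §3. Units: pairs attached to ring embeddings that differ by a Galois automorphism -/

section Units

open Field DiscreteGaloisModule

-- As in the tree's `PoitouTate.lean` / `LocalTatePairing.lean`: the classes `twoCocycleClass` need
-- `LocallyCompactSpace Γ_K`, whose only source for a general field is this theorem; local, no override.
attribute [local instance] absoluteGaloisGroup_compactSpace

variable {F E : Type} [Field F] [Field E] [Algebra F E] (K : Type) [Field K]

/-- The action of `Rep.ofAlgebraAutOnUnits F E` on a unit: `g · u = g(u)` (Mathlib `AlgEquiv.smul_units_def`).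
[cite: SerreLocalFields1979, Ch. X §1 (the `G`-module `Lˣ`)] -/
theorem ofAlgebraAutOnUnits_ρ_ofMul (g : E ≃ₐ[F] E) (u : Eˣ) :
    (Rep.ofAlgebraAutOnUnits F E).ρ g (Additive.ofMul u) = Additive.ofMul (Units.map (g : E →* E) u) := by
  change Additive.ofMul (g • u) = _
  rw [AlgEquiv.smul_units_def]

/-- For a compatible pair `(Γ_K, K̄ˣ) → (Gal(E/F), Eˣ)` whose module component is a ring embedding
`ι : E → K̄`, compatibility reads `ι (f(s) x) = s · ι(x)` for every `x ∈ E`.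
[cite: SerreGaloisCohomology1997, Ch. I §2.4] -/
theorem CompatiblePair.apply_f_apply_eq_smul (P : CompatiblePair (Rep.ofAlgebraAutOnUnits F E) (units K).toTopRep)
    (ι : E →+* AlgebraicClosure K)
    (hP : ∀ u : Eˣ, P.φ (Additive.ofMul u) = UnitsCarrier.ofUnits (Units.map (ι : E →* AlgebraicClosure K) u))
    (s : absoluteGaloisGroup K) (x : E) : ι (P.f s x) = s • ι x := by
  by_cases hx : x = 0
  · rw [hx, map_zero (P.f s), map_zero, smul_zero]
  · have h := P.comm s (Additive.ofMul (Units.mk0 x hx))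
    rw [ofAlgebraAutOnUnits_ρ_ofMul] at h
    have h1 : UnitsCarrier.ofUnits (Units.map (ι : E →* AlgebraicClosure K)
          (Units.map (P.f s : E →* E) (Units.mk0 x hx))) =
        units K s (UnitsCarrier.ofUnits (Units.map (ι : E →* AlgebraicClosure K) (Units.mk0 x hx))) :=
      ((hP _).symm.trans h).trans (hP _ ▸ rfl)
    have h' : ((UnitsCarrier.toAdditive (UnitsCarrier.ofUnits (Units.map (ι : E →* AlgebraicClosure K)
          (Units.map (P.f s : E →* E) (Units.mk0 x hx))))).toMul : AlgebraicClosure K) =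
        ((UnitsCarrier.toAdditive (units K s (UnitsCarrier.ofUnits
          (Units.map (ι : E →* AlgebraicClosure K) (Units.mk0 x hx))))).toMul : AlgebraicClosure K) :=
      congrArg (fun w : UnitsCarrier K => ((UnitsCarrier.toAdditive w).toMul : AlgebraicClosure K)) h1
    rw [units_apply_apply, toMul_ofMul, Units.coe_smul] at h'
    exact h'

/-- **Two compatible pairs `(Γ_K, K̄ˣ) → (Gal(E/F), Eˣ)` whose module components are ring embeddings
`ι₁, ι₂ : E → K̄` with `ι₂ = ι₁ ∘ σ` (`σ ∈ Gal(E/F)`) induce the same map `H²(Gal(E/F), Eˣ) → H²(K, K̄ˣ)`.**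
The group components then satisfy `f₂(s) = σ⁻¹ f₁(s) σ` automatically (`ι₁` is injective and both pairs are
compatible), so `twoCocycleClass_pull_eq_of_conj` applies.
[cite: SerreLocalFields1979, Ch. VII §5 Prop. 3][cite: SerreGaloisCohomology1997, Ch. I §2.4–2.5] -/
theorem CompatiblePair.twoCocycleClass_pull_eq_of_ringHom_eq_comp
    (P₁ P₂ : CompatiblePair (Rep.ofAlgebraAutOnUnits F E) (units K).toTopRep)
    (ι₁ ι₂ : E →+* AlgebraicClosure K) (σ : E ≃ₐ[F] E)
    (h₁ : ∀ u : Eˣ, P₁.φ (Additive.ofMul u) = UnitsCarrier.ofUnits (Units.map (ι₁ : E →* AlgebraicClosure K) u))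
    (h₂ : ∀ u : Eˣ, P₂.φ (Additive.ofMul u) = UnitsCarrier.ofUnits (Units.map (ι₂ : E →* AlgebraicClosure K) u))
    (hι : ∀ x : E, ι₂ x = ι₁ (σ x)) (b : cocycles₂ (Rep.ofAlgebraAutOnUnits F E)) :
    twoCocycleClass (units K).toTopRep (P₂.pull b) = twoCocycleClass (units K).toTopRep (P₁.pull b) := by
  refine CompatiblePair.twoCocycleClass_pull_eq_of_conj P₁ P₂ σ (fun s => ?_) (fun a => ?_) b
  · -- `σ f₂(s) = f₁(s) σ` on every `x ∈ E`, read through the injective `ι₁`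
    have key : σ * P₂.f s = P₁.f s * σ := by
      refine AlgEquiv.ext fun x => ?_
      rw [AlgEquiv.mul_apply, AlgEquiv.mul_apply]
      apply ι₁.injective
      rw [← hι, P₂.apply_f_apply_eq_smul K ι₂ h₂, P₁.apply_f_apply_eq_smul K ι₁ h₁, hι]
    rw [mul_assoc, ← key, inv_mul_cancel_left]
  · obtain ⟨u, rfl⟩ := (Additive.ofMul : Eˣ ≃ Additive Eˣ).surjective a
    refine (h₂ u).trans (Eq.trans ?_
      ((congrArg P₁.φ (ofAlgebraAutOnUnits_ρ_ofMul σ u)).trans (h₁ _)).symm)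
    refine congrArg UnitsCarrier.ofUnits (Units.ext ?_)
    simp only [Units.coe_map, MonoidHom.coe_coe]
    exact hι _

end Units

end Literature.NumberTheory.GaloisRepresentations

end
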